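import Literature.NumberTheory.EllipticCurves.BSDShaProofs
import Literature.GroupTheory.FiniteAbelian.AlternatingPairing
import HarnessLib

/-!
# Second-layer descent certificate, ALGEBRA: `T[p] ∩ pT ≠ 0` under an alternating non-degenerate
# pairing forces `p⁴ ∣ #T`; for `Ш(E/K)` with the Cassels–Tate pairing, `Ш[p] ≠ 0 ∧ Ш[p] ⊆ pШ ⇒ p⁴ ∣ #Ш`
# (cell `bsd-eis`, seat `bsd-eis-k5-c5` g3; helper of `EisensteinPrimesMazurMCOnX1RankZeroSecondDescent.lean`,
# crux 5 `MazurMCOnX1RankZero`, item stmt-BirchSwinnertonDyer-19035; THEOREMS ONLY, nothing booked)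

HONEST FRAMING (cell `bsd-eis`, home `run/shared/lean/pub/bsd-eis/`): pure algebra and its `Ш`-level
reading; nothing here is a statement about BSD. The consumer file turns `p⁴ ∣ #Ш(E)` into `BSD(E,p)` at
rank-`0` X1 pairs with `ord_p #Ш_an ≤ 4` (Wuthrich 2014 Prop. 21 gives the other inequality), for the 13
row-A3 cells whose first `3`-isogeny descent sees `Ш[3] ≠ 0` only on the member with `#Ш_an = 81`.

**The count.** A finite abelian group `T` with an alternating bi-additive pairing `B : T × T → ℚ/ℤ` that is
non-degenerate, and with `T[p] ∩ pT ≠ 0`, has `p⁴ ∣ #T`: `#T = #pT · #T[p]`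
(`natCard_eq_natCard_range_mul_natCard_torsionBy`); the induced pairing on `T/T[p]` is alternating and
non-degenerate (tree theorem `FiniteAbelian.exists_quotTorsionPairing`), so `#(T/T[p])[p] = p^{2k}`
(`exists_natCard_torsionBy_eq_pow_two_mul_of_circle`) and `(T/T[p])[p] ≅ T[p] ∩ pT`
(`natCard_torsionBy_quot_eq`); `T[p] ∩ pT ≠ 0` forces `k ≥ 1`, and `#(T[p] ∩ pT)` divides `#T[p]` and
`#pT`. Classically (Cassels 1962, Tate 1963) such a `T` is `M × M` and contains `(ℤ/p²)²`; only the
divisibility is proved. Three certificate shapes feed it: (i) `T[p] ≠ 0 ∧ T[p] ⊆ pT`; (ii) one element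
of order `p²`; (iii) `T[p] ≠ 0` and "`B` vanishes on `T[p] × T[p]`" — (iii) ⇒ (i) because the orthogonal
of `T[p]` is `pT` (tree theorem `FiniteAbelian.mem_range_nsmul_of_forall_torsionBy`). §2 applies this to
`T = Ш(E/K)` (finite) with `B` the Cassels–Tate pairing of the named fact
`WeierstrassCurve.exists_casselsTate_pairing` (bsd.S18: alternating, kernel = divisible part, hence
non-degenerate on a finite `Ш` — `divisibleElements_eq_bot_of_finite`), in the three shapes, plus the
PAIRING FORM quantified over every pairing with the fact's properties (the form that does not presuppose
which such pairing an instrument computed; no loss, `pairing_eq_zero_of_forall_exists_nsmul`).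

References: Cassels, J. reine angew. Math. 211 (1962) [Cassels1962ArithmeticIV]; Silverman AEC X.4.14
[SilvermanAEC2009]; Milne ADT I.6.13 [MilneADT2006]; Poonen–Stoll, Ann. of Math. 150 (1999) §1.
-/

set_option autoImplicit false
set_option linter.dupNamespace false

noncomputable section

open scoped Classical AddSubgroup

open WeierstrassCurve Literature.NumberTheory.EllipticCurves Literature.GroupTheory.FiniteAbelian

universe u

namespace Summit.BirchSwinnertonDyer.BirchSwinnertonDyer.Theorems.EisensteinPrimesMazurMCOnX1RankZeroSecondDescentAlgebra

/-! ### §1 Pure algebra: `T[p] ∩ pT ≠ 0` under an alternating non-degenerate pairing forces `p⁴ ∣ #T` -/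

section Algebra

variable {T : Type u} [AddCommGroup T] (p : ℕ)

/-- **`#T = #pT · #T[p]`** for a finite abelian group (first isomorphism theorem for `x ↦ p•x`, whose
kernel is `T[p]`). [folklore] -/
theorem natCard_eq_natCard_range_mul_natCard_torsionBy [Finite T] :
    Nat.card T = Nat.card (nsmulAddMonoidHom (α := T) p).range * Nat.card T[(p : ℤ)] := by
  have h := AddSubgroup.card_eq_card_quotient_mul_card_addSubgroup
    (nsmulAddMonoidHom (α := T) p).ker
  rwa [Nat.card_congr (QuotientAddGroup.quotientKerEquivRange (nsmulAddMonoidHom (α := T) p)).toEquiv,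
    ker_nsmulAddMonoidHom_eq] at h

/-- **Certificate shape (i): `T[p] ≠ 0` and `T[p] ⊆ pT` give `T[p] ∩ pT ≠ 0`.** [folklore] -/
theorem inf_ne_bot_of_exists_torsion_of_forall_exists_nsmul
    (hx : ∃ x : T, x ≠ 0 ∧ p • x = 0) (hdiv : ∀ x : T, p • x = 0 → ∃ y : T, p • y = x) :
    T[(p : ℤ)] ⊓ (nsmulAddMonoidHom (α := T) p).range ≠ ⊥ := by
  obtain ⟨x, hx0, hpx⟩ := hx
  obtain ⟨y, rfl⟩ := hdiv x hpx
  intro h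
  apply hx0
  rw [← AddSubgroup.mem_bot, ← h, AddSubgroup.mem_inf]
  exact ⟨AddSubgroup.torsionBy.nsmul_iff.mpr hpx, ⟨y, rfl⟩⟩

variable [Fact p.Prime]

/-- **Certificate shape (ii): an element of order `p²` gives `T[p] ∩ pT ≠ 0`** (`p • x` is a
non-zero element of `T[p] ∩ pT`). [folklore] -/
theorem inf_ne_bot_of_exists_addOrderOf_eq_sq (hx : ∃ x : T, addOrderOf x = p ^ 2) :
    T[(p : ℤ)] ⊓ (nsmulAddMonoidHom (α := T) p).range ≠ ⊥ := by
  obtain ⟨x, hx⟩ := hx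
  have hp : p.Prime := Fact.out
  have hpx : p • x ≠ 0 := by
    intro h0
    have hdvd : addOrderOf x ∣ p := addOrderOf_dvd_of_nsmul_eq_zero h0
    rw [hx, pow_two] at hdvd
    have hle : p * p ≤ p := Nat.le_of_dvd hp.pos hdvd
    have h1 : 1 < p := hp.one_lt
    nlinarith
  have hppx : p • (p • x) = 0 := by
    rw [← mul_nsmul', ← pow_two, ← hx]
    exact addOrderOf_nsmul_eq_zero x
  intro h
  apply hpx
  rw [← AddSubgroup.mem_bot, ← h, AddSubgroup.mem_inf]
  exact ⟨AddSubgroup.torsionBy.nsmul_iff.mpr hppx, ⟨x, rfl⟩⟩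

/-- **Certificate shape (iii): if an alternating non-degenerate `ℚ/ℤ`-valued pairing on a finite `T`
vanishes on `T[p] × T[p]`, then `T[p] ⊆ pT`** — the orthogonal of `T[p]` is `pT`
(`FiniteAbelian.mem_range_nsmul_of_forall_torsionBy`, with `(ℚ/ℤ)[p] ↪ 𝔽_p`). This is the READING of
an instrument verdict "the Cassels–Tate pairing is identically zero on `Ш[p]`". [folklore] -/
theorem forall_exists_nsmul_of_pairing_eq_zero [Finite T] (B : T →+ T →+ AddCircle (1 : ℚ))
    (halt : ∀ x, B x x = 0) (hnd : ∀ x, (∀ y, B x y = 0) → x = 0)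
    (h0 : ∀ x y : T, p • x = 0 → p • y = 0 → B x y = 0) :
    ∀ x : T, p • x = 0 → ∃ y : T, p • y = x := by
  intro x hx
  obtain ⟨ι, hι⟩ := exists_circleTorsion_toZMod_injective p
  obtain ⟨y, hy⟩ := mem_range_nsmul_of_forall_torsionBy p B halt hnd ι hι (x := x)
    (fun y hy ↦ h0 x y hx (AddSubgroup.torsionBy.nsmul_iff.mp hy))
  exact ⟨y, hy⟩

/-- **The core count.** A finite abelian group `T` with an alternating non-degenerate bi-additive
pairing `B : T × T → ℚ/ℤ` and `T[p] ∩ pT ≠ 0` satisfies `p⁴ ∣ #T`: the induced pairing on `T/T[p]`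
(`exists_quotTorsionPairing`) is alternating and non-degenerate, so `#(T/T[p])[p] = p^{2k}`
(`exists_natCard_torsionBy_eq_pow_two_mul_of_circle`), and `(T/T[p])[p] ≅ T[p] ∩ pT`
(`natCard_torsionBy_quot_eq`); `T[p] ∩ pT ≠ 0` forces `k ≥ 1`, so `p²` divides `#(T[p] ∩ pT)`, which
divides both `#T[p]` and `#pT`; and `#T = #pT · #T[p]`. (Classically: `T ≅ M × M` contains `(ℤ/p²)²`.)
[folklore] -/
theorem pow_four_dvd_natCard_of_alternating_of_inf_ne_bot [Finite T]
    (B : T →+ T →+ AddCircle (1 : ℚ)) (halt : ∀ x, B x x = 0)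
    (hnd : ∀ x, (∀ y, B x y = 0) → x = 0)
    (hR : T[(p : ℤ)] ⊓ (nsmulAddMonoidHom (α := T) p).range ≠ ⊥) : p ^ 4 ∣ Nat.card T := by
  obtain ⟨B', halt', hnd'⟩ := exists_quotTorsionPairing p B halt hnd
  obtain ⟨k, hk⟩ :=
    exists_natCard_torsionBy_eq_pow_two_mul_of_circle p (T ⧸ T[(p : ℤ)]) B' halt' hnd'
  rw [natCard_torsionBy_quot_eq] at hk
  have hk0 : k ≠ 0 := by
    rintro rfl
    exact hR (AddSubgroup.eq_bot_of_card_eq _ (by simpa using hk))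
  have hp2 : p ^ 2 ∣ Nat.card ↥(T[(p : ℤ)] ⊓ (nsmulAddMonoidHom (α := T) p).range) :=
    ⟨p ^ (2 * k - 2), by rw [hk, ← pow_add]; congr 1; omega⟩
  have h1 : Nat.card ↥(T[(p : ℤ)] ⊓ (nsmulAddMonoidHom (α := T) p).range) ∣ Nat.card T[(p : ℤ)] :=
    AddSubgroup.card_dvd_of_le inf_le_left
  have h2 : Nat.card ↥(T[(p : ℤ)] ⊓ (nsmulAddMonoidHom (α := T) p).range) ∣
      Nat.card (nsmulAddMonoidHom (α := T) p).range :=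
    AddSubgroup.card_dvd_of_le inf_le_right
  rw [natCard_eq_natCard_range_mul_natCard_torsionBy p, show (4 : ℕ) = 2 + 2 from rfl, pow_add]
  exact mul_dvd_mul (hp2.trans h2) (hp2.trans h1)

/-- `p⁴ ∣ #T` from shape (i): `T[p] ≠ 0` and `T[p] ⊆ pT`. [folklore] -/
theorem pow_four_dvd_natCard_of_alternating_of_forall_exists_nsmul [Finite T]
    (B : T →+ T →+ AddCircle (1 : ℚ)) (halt : ∀ x, B x x = 0)
    (hnd : ∀ x, (∀ y, B x y = 0) → x = 0)
    (hx : ∃ x : T, x ≠ 0 ∧ p • x = 0) (hdiv : ∀ x : T, p • x = 0 → ∃ y : T, p • y = x) :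
    p ^ 4 ∣ Nat.card T :=
  pow_four_dvd_natCard_of_alternating_of_inf_ne_bot p B halt hnd
    (inf_ne_bot_of_exists_torsion_of_forall_exists_nsmul p hx hdiv)

/-- `p⁴ ∣ #T` from shape (ii): an element of order `p²`. [folklore] -/
theorem pow_four_dvd_natCard_of_alternating_of_addOrderOf_eq_sq [Finite T]
    (B : T →+ T →+ AddCircle (1 : ℚ)) (halt : ∀ x, B x x = 0)
    (hnd : ∀ x, (∀ y, B x y = 0) → x = 0) (hx : ∃ x : T, addOrderOf x = p ^ 2) :
    p ^ 4 ∣ Nat.card T :=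
  pow_four_dvd_natCard_of_alternating_of_inf_ne_bot p B halt hnd
    (inf_ne_bot_of_exists_addOrderOf_eq_sq p hx)

/-- `p⁴ ∣ #T` from shape (iii): `T[p] ≠ 0` and the pairing vanishes on `T[p] × T[p]`. [folklore] -/
theorem pow_four_dvd_natCard_of_alternating_of_pairing_eq_zero [Finite T]
    (B : T →+ T →+ AddCircle (1 : ℚ)) (halt : ∀ x, B x x = 0)
    (hnd : ∀ x, (∀ y, B x y = 0) → x = 0) (hx : ∃ x : T, x ≠ 0 ∧ p • x = 0)
    (h0 : ∀ x y : T, p • x = 0 → p • y = 0 → B x y = 0) : p ^ 4 ∣ Nat.card T :=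
  pow_four_dvd_natCard_of_alternating_of_forall_exists_nsmul p B halt hnd hx
    (forall_exists_nsmul_of_pairing_eq_zero p B halt hnd h0)

end Algebra

/-! ### §2 `Ш(E/K)`: `p⁴ ∣ #Ш` from the Cassels–Tate pairing and the certificate (three shapes) -/

section Sha

variable {K : Type} [Field K] [NumberField K] (W : WeierstrassCurve K) [W.IsElliptic]
  (p : ℕ) [Fact p.Prime]

/-- On a finite `Ш(E/K)` the Cassels–Tate pairing of `exists_casselsTate_pairing` (alternating, kernel =
divisible elements) is NON-DEGENERATE: a finite group has no non-zero divisible element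
(`divisibleElements_eq_bot_of_finite`). [cite: SilvermanAEC2009, Thm. X.4.14] -/
theorem exists_nondegenerate_pairing_of_casselsTate (hCT : exists_casselsTate_pairing (K := K))
    (hfin : W.ShaFinite) :
    ∃ B : W.sha →+ W.sha →+ AddCircle (1 : ℚ), (∀ x, B x x = 0) ∧ ∀ x, (∀ y, B x y = 0) → x = 0 := by
  haveI : Finite W.sha := hfin
  obtain ⟨B, halt, hker⟩ := hCT W
  refine ⟨B, halt, fun x hx0 ↦ ?_⟩
  have hmem : x ∈ AddSubgroup.divisibleElements W.sha := (hker x).mp hx0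
  rwa [divisibleElements_eq_bot_of_finite, AddSubgroup.mem_bot] at hmem

/-- **`p⁴ ∣ #Ш(E/K)` from the two READ data `Ш[p] ≠ 0` and `Ш[p] ⊆ pШ`** (finite `Ш`; Cassels–Tate
pairing `hCT` = bsd.S18). The second datum is the reading of "the Cassels–Tate pairing vanishes on
`Ш[p] × Ш[p]`" (`forall_exists_nsmul_of_pairing_eq_zero`). [cite: SilvermanAEC2009, Thm. X.4.14]
[cite: MilneADT2006, Thm. I.6.13] -/
theorem pow_four_dvd_shaOrder_of_casselsTate_of_forall_exists_nsmul
    (hCT : exists_casselsTate_pairing (K := K)) (hfin : W.ShaFinite)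
    (hx : ∃ x : W.sha, x ≠ 0 ∧ p • x = 0) (hdiv : ∀ x : W.sha, p • x = 0 → ∃ y : W.sha, p • y = x) :
    p ^ 4 ∣ W.shaOrder := by
  haveI : Finite W.sha := hfin
  obtain ⟨B, halt, hnd⟩ := exists_nondegenerate_pairing_of_casselsTate W hCT hfin
  rw [WeierstrassCurve.shaOrder]
  exact pow_four_dvd_natCard_of_alternating_of_forall_exists_nsmul p B halt hnd hx hdiv

/-- **`p⁴ ∣ #Ш(E/K)` from ONE element of `Ш(E/K)` of order `p²`** (finite `Ш`; Cassels–Tate pairing).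
[cite: SilvermanAEC2009, Thm. X.4.14] [cite: MilneADT2006, Thm. I.6.13] -/
theorem pow_four_dvd_shaOrder_of_casselsTate_of_addOrderOf_eq_sq
    (hCT : exists_casselsTate_pairing (K := K)) (hfin : W.ShaFinite)
    (hx : ∃ x : W.sha, addOrderOf x = p ^ 2) : p ^ 4 ∣ W.shaOrder := by
  haveI : Finite W.sha := hfin
  obtain ⟨B, halt, hnd⟩ := exists_nondegenerate_pairing_of_casselsTate W hCT hfin
  rw [WeierstrassCurve.shaOrder]
  exact pow_four_dvd_natCard_of_alternating_of_addOrderOf_eq_sq p B halt hnd hx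

/-- **`p⁴ ∣ #Ш(E/K)` from `Ш[p] ≠ 0` and the PAIRING FORM of the certificate:** every alternating
pairing on `Ш(E/K)` whose kernel is the divisible part (the properties of the Cassels–Tate pairing
recorded by `exists_casselsTate_pairing`) vanishes on `Ш[p] × Ш[p]` — the form that does not presuppose
WHICH such pairing the instrument computed (for a group with `Ш[p] ⊆ pШ` EVERY bi-additive pairing
vanishes there, so nothing is lost). [cite: SilvermanAEC2009, Thm. X.4.14] [cite: MilneADT2006, Thm. I.6.13] -/
theorem pow_four_dvd_shaOrder_of_casselsTate_of_pairing_eq_zero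
    (hCT : exists_casselsTate_pairing (K := K)) (hfin : W.ShaFinite)
    (hx : ∃ x : W.sha, x ≠ 0 ∧ p • x = 0)
    (h0 : ∀ B : W.sha →+ W.sha →+ AddCircle (1 : ℚ), (∀ x, B x x = 0) →
      (∀ x, (∀ y, B x y = 0) ↔ x ∈ AddSubgroup.divisibleElements W.sha) →
      ∀ x y : W.sha, p • x = 0 → p • y = 0 → B x y = 0) :
    p ^ 4 ∣ W.shaOrder := by
  haveI : Finite W.sha := hfin
  obtain ⟨B, halt, hker⟩ := hCT W
  have hnd : ∀ x : W.sha, (∀ y, B x y = 0) → x = 0 := fun x hx0 ↦ by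
    have hmem : x ∈ AddSubgroup.divisibleElements W.sha := (hker x).mp hx0
    rwa [divisibleElements_eq_bot_of_finite, AddSubgroup.mem_bot] at hmem
  rw [WeierstrassCurve.shaOrder]
  exact pow_four_dvd_natCard_of_alternating_of_pairing_eq_zero p B halt hnd hx (h0 B halt hker)

omit [W.IsElliptic] [Fact p.Prime] in
/-- Converse bookkeeping: if `Ш[p] ⊆ pШ` then EVERY bi-additive pairing vanishes on `Ш[p] × Ш[p]`
(`B (p•a) y = B a (p•y) = 0`), so the pairing form of the certificate is implied by the subgroup form.
[folklore] -/
theorem pairing_eq_zero_of_forall_exists_nsmul {Q : Type} [AddCommGroup Q]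
    (hdiv : ∀ x : W.sha, p • x = 0 → ∃ y : W.sha, p • y = x) (B : W.sha →+ W.sha →+ Q)
    (x y : W.sha) (hx : p • x = 0) (hy : p • y = 0) : B x y = 0 := by
  obtain ⟨a, rfl⟩ := hdiv x hx
  rw [map_nsmul, AddMonoidHom.nsmul_apply, ← map_nsmul, hy, map_zero]

end Sha

end Summit.BirchSwinnertonDyer.BirchSwinnertonDyer.Theorems.EisensteinPrimesMazurMCOnX1RankZeroSecondDescentAlgebra

end
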